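import Summits.Ventures.LatticeQCDFlow.Exactness.IMHAnyStartSplit
import HarnessLib

/-!
# The residual kernel of flow-MCMC in closed form: the non-equilibrium part of every run is a `π`-reversible chain
# with `q`-density `min(1, w(y)/w(x)) − w(y)/w(x₀)` off the diagonal, holding mass `(1 − A(x))/(1 − A)`, absorbed at the modes

HONEST FRAMING: exact (Metropolis-corrected) sampling algorithms for lattice gauge theory;
figures of merit are autocorrelation/cost numbers at stated couplings and volumes; no
continuum-physics claim.

Venture `LatticeQCDFlow` (cell pub-lqcd), topic `Exactness`; FANOUT row 30 (lean-1, GEN-35).  NEW WORK of the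
cell, general state space.  `K = indepMH q w` (normalised weight `w` maximal at `x₀`, `W = w(x₀) > 1`, `A = 1/W`,
`A(x) = imhAcceptMass q w x` the acceptance mass at `x`, `π = w·q`).  GEN-34 split every run as
`μ₀Kⁿ = (1 − rⁿ)·π + rⁿ·μ₀Rⁿ` with the residual kernel `R = (K − A·π)/(1 − A)` of
`Literature/Probability/MarkovChains/DoeblinMinorization` and recorded «the residual law of a particular non-modal
start: no closed form».  The KERNEL has one:

* §1 **`indepMH_residual_integrand_le`** — pointwise `w(y)/W ≤ min(1, w(y)/w(x))`: the Doeblin component `A·π` sits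
  under the move part of `K` at every pair of states; **`indepMH_residual_density_eq`** — the difference is
  `min(1, w(y)/w(x)) − w(y)/W = w(y)·(min(1/w(x), 1/w(y)) − 1/W) ≥ 0`, SYMMETRIC after division by `w(y)`: the
  residual move density with respect to `π` is `(min(1/w(x), 1/w(y)) − A)/(1 − A)`.
* §2 **`residual_indepMH_apply`** — THE CLOSED FORM: for every `x` and measurable `B`,
  `R(x, B) = (1 − A)⁻¹·( ∫_B (min(1, w(y)/w(x)) − w(y)/W) q(dy) + (1 − A(x))·1_B(x) )`.
* §3 **`residual_indepMH_isReversible`** — `R` IS `π`-REVERSIBLE (detailed balance), from the reversibility of `K`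
  (tree) and the symmetry of `A·π(A)·π(B)`; in particular `πR = π` (GEN-34's `bind_residual_indepMH_target`,
  recovered).
* §4 **`residual_indepMH_apply_singleton_ge`** — THE RESIDUAL CHAIN IS LAZIER THAN THE SAMPLER EVERYWHERE:
  `R(x, {x}) ≥ (1 − A(x))/(1 − A) ≥ 1 − A(x)`, with equality in the first step when the proposal has no atom at `x`
  (**`residual_indepMH_apply_singleton_eq`**); so (**`residual_indepMH_apply_singleton_eq_one_iff`**) for an
  atom-free `x`: `R(x, {x}) = 1 ↔ A(x) = A` — THE RESIDUAL CHAIN IS ABSORBED EXACTLY AT THE STATES OF MINIMAL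
  ACCEPTANCE, the modes of `w` (GEN-34's `R(x₀, ·) = δ_{x₀}` is the instance `x = x₀`).

Reading: the start-up transient `rⁿ·μ₀Rⁿ` of an exact sampler from any start is carried by a reversible chain that
moves `x → y` at `q`-rate `min(1, w(y)/w(x)) − A·w(y)` and otherwise holds; near-modal configurations (acceptance
`A(x)` close to `A`) are nearly absorbing for it — the transient of a run started near the cold configuration is a
frozen stretch, as the cold-start laws of GEN-31–33 showed at the mode itself.
NOT CLAIMED: the `n`-step residual law `μ₀Rⁿ` in closed form; spectral statements about `R`; any number for a
concrete weight.  No `sorry`, no new definitions (the residual kernel is the Literature definition), nothing cited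
as a fact.
-/

noncomputable section

namespace Summit.Ventures.LatticeQCDFlow.Exactness

open MeasureTheory ProbabilityTheory Function Finset
open scoped ENNReal
open Summit.Ventures.LatticeQCDFlow.Scoring Literature.Probability.MarkovChains

variable {Ω : Type*} [MeasurableSpace Ω] {q : Measure Ω} [IsProbabilityMeasure q] {w : Ω → ℝ}

/-! ## §1 The Doeblin component sits under the move density, pointwise -/

omit [MeasurableSpace Ω] in
/-- **`w(y)/W ≤ min(1, w(y)/w(x))`** for `0 < w ≤ W = w(x₀)`. [ours, bookkeeping] -/
theorem indepMH_residual_integrand_le (hw0 : ∀ y, 0 < w y) {x₀ : Ω} (hmax : ∀ y, w y ≤ w x₀) (x y : Ω) :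
    w y / w x₀ ≤ min 1 (w y / w x) := by
  have hWpos : 0 < w x₀ := hw0 x₀
  refine le_min ?_ ?_
  · rw [div_le_one hWpos]; exact hmax y
  · exact div_le_div_of_nonneg_left (hw0 y).le (hw0 x) (hmax x)

omit [MeasurableSpace Ω] in
/-- **The residual move density**: `min(1, w(y)/w(x)) − w(y)/W = w(y)·(min(1/w(x), 1/w(y)) − 1/W)`, and it is
nonnegative. [ours] -/
theorem indepMH_residual_density_eq (hw0 : ∀ y, 0 < w y) {x₀ : Ω} (hmax : ∀ y, w y ≤ w x₀) (x y : Ω) :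
    min 1 (w y / w x) - w y / w x₀ = w y * (min (w x)⁻¹ (w y)⁻¹ - (w x₀)⁻¹) ∧
      0 ≤ min 1 (w y / w x) - w y / w x₀ := by
  have hy : 0 < w y := hw0 y
  refine ⟨?_, sub_nonneg.2 (indepMH_residual_integrand_le hw0 hmax x y)⟩
  have h1 : min 1 (w y / w x) = w y * min (w x)⁻¹ (w y)⁻¹ := by
    rw [mul_min_of_nonneg _ _ hy.le, mul_inv_cancel₀ hy.ne', ← div_eq_mul_inv, min_comm]
  rw [h1, div_eq_mul_inv, mul_sub]

/-! ## §2 The closed form of the residual kernel -/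

/-- **THE RESIDUAL KERNEL IN CLOSED FORM.**  `w` measurable (a `Fact`), positive, normalised, maximal at `x₀` with
`R` the residual kernel of the exact minorisation `K ≥ (1/w(x₀))·π`.  For every `x` and measurable `B`:
`R(x, B) = (1 − 1/w(x₀))⁻¹·( ∫_B (min(1, w(y)/w(x)) − w(y)/w(x₀)) q(dy) + (1 − A(x))·1_B(x) )`. [ours] -/
theorem residual_indepMH_apply [Fact (Measurable w)] (hw0 : ∀ y, 0 < w y) {x₀ : Ω} (hmax : ∀ y, w y ≤ w x₀)
    [IsProbabilityMeasure (q.withDensity fun y => ENNReal.ofReal (w y))] (x : Ω) {B : Set Ω} (hB : MeasurableSet B) :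
    Doeblin.residualKernel (indepMH q w) (q.withDensity fun y => ENNReal.ofReal (w y))
        (ENNReal.ofReal (w x₀)⁻¹) (indepMH_minorised_mode Fact.out hw0 hmax) x B =
      (1 - ENNReal.ofReal (w x₀)⁻¹)⁻¹ *
        (∫⁻ y in B, ENNReal.ofReal (min 1 (w y / w x) - w y / w x₀) ∂q +
          (1 - imhAcceptMass q w x) * B.indicator 1 x) := by
  have hw : Measurable w := Fact.out
  have hWpos : 0 < w x₀ := hw0 x₀
  have hA0 : 0 ≤ (w x₀)⁻¹ := inv_nonneg.2 hWpos.le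
  rw [Doeblin.residualKernel_apply x hB, indepMH_apply hw x hB, withDensity_apply _ hB]
  congr 1
  -- `ε·π(B) = ∫_B w(y)/W dq`
  have hεπ : ENNReal.ofReal (w x₀)⁻¹ * ∫⁻ y in B, ENNReal.ofReal (w y) ∂q =
      ∫⁻ y in B, ENNReal.ofReal (w y / w x₀) ∂q := by
    rw [← lintegral_const_mul _ hw.ennreal_ofReal]
    refine lintegral_congr fun y => ?_
    rw [← ENNReal.ofReal_mul hA0, div_eq_inv_mul]
  rw [hεπ]
  -- the subtracted integral is finite and pointwise below the move part
  have hmeas : Measurable fun y => ENNReal.ofReal (w y / w x₀) := (hw.div_const _).ennreal_ofReal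
  have hle : ∀ y, ENNReal.ofReal (w y / w x₀) ≤ imhAcceptE w x y := fun y =>
    ENNReal.ofReal_le_ofReal (indepMH_residual_integrand_le hw0 hmax x y)
  have hfin : ∫⁻ y in B, ENNReal.ofReal (w y / w x₀) ∂q ≠ ⊤ := by
    refine ne_top_of_le_ne_top (b := ∫⁻ _ in B, ENNReal.ofReal 1 ∂q) ?_ (lintegral_mono fun y => ?_)
    · rw [lintegral_const]; exact ENNReal.mul_ne_top ENNReal.ofReal_ne_top (measure_ne_top _ _)
    · exact ENNReal.ofReal_le_ofReal ((div_le_one hWpos).2 (hmax y))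
  rw [← (ENNReal.cancel_of_ne hfin).tsub_add_eq_add_tsub (lintegral_mono fun y => hle y),
    ← lintegral_sub hmeas hfin (ae_of_all _ hle)]
  congr 1
  refine lintegral_congr fun y => ?_
  rw [imhAcceptE, imhAccept, ENNReal.ofReal_sub _ (div_nonneg (hw0 y).le hWpos.le)]

/-! ## §3 The residual kernel is reversible with respect to the target -/

/-- **`R` IS `π`-REVERSIBLE**: `∫_A R(x, B) π(dx) = ∫_B R(x, A) π(dx)` for all measurable `A`, `B`. [ours] -/
theorem residual_indepMH_isReversible [Fact (Measurable w)] (hw0 : ∀ y, 0 < w y) {x₀ : Ω} (hmax : ∀ y, w y ≤ w x₀)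
    [IsProbabilityMeasure (q.withDensity fun y => ENNReal.ofReal (w y))] :
    Kernel.IsReversible
      (Doeblin.residualKernel (indepMH q w) (q.withDensity fun y => ENNReal.ofReal (w y))
        (ENNReal.ofReal (w x₀)⁻¹) (indepMH_minorised_mode Fact.out hw0 hmax))
      (q.withDensity fun y => ENNReal.ofReal (w y)) := by
  set π : Measure Ω := q.withDensity fun y => ENNReal.ofReal (w y) with hπ
  set ε : ℝ≥0∞ := ENNReal.ofReal (w x₀)⁻¹ with hε
  have hw : Measurable w := Fact.out
  have hmin := indepMH_minorised_mode (q := q) hw hw0 hmax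
  have hrev := indepMH_isReversible (q := q) hw hw0
  -- `∫_A R(x, B) dπ = (1 − ε)⁻¹ (∫_A K(x, B) dπ − ε π(B) π(A))`
  have hside : ∀ {A B : Set Ω}, MeasurableSet A → MeasurableSet B →
      ∫⁻ x in A, Doeblin.residualKernel (indepMH q w) π ε hmin x B ∂π =
        (1 - ε)⁻¹ * (∫⁻ x in A, indepMH q w x B ∂π - ε * π B * π A) := by
    intro A B hA hB
    have happ : ∀ x, Doeblin.residualKernel (indepMH q w) π ε hmin x B =
        (1 - ε)⁻¹ * (indepMH q w x B - ε * π B) := fun x => Doeblin.residualKernel_apply x hB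
    simp_rw [happ]
    have hKm : Measurable fun x => indepMH q w x B := Kernel.measurable_coe _ hB
    have hm2 : Measurable fun x => indepMH q w x B - ε * π B := hKm.sub measurable_const
    rw [lintegral_const_mul _ hm2]
    congr 1
    have hfin : ∫⁻ _ in A, ε * π B ∂π ≠ ⊤ := by
      rw [lintegral_const]
      exact ENNReal.mul_ne_top (ENNReal.mul_ne_top ENNReal.ofReal_ne_top (measure_ne_top _ _))
        (measure_ne_top _ _)
    rw [lintegral_sub measurable_const hfin (ae_of_all _ fun x => hmin x hB), lintegral_const,
      Measure.restrict_apply MeasurableSet.univ, Set.univ_inter]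
  intro A B hA hB
  rw [hside hA hB, hside hB hA, hrev hA hB, mul_right_comm]

/-! ## §4 Holding: the residual chain is lazier than the sampler, absorbed exactly at the modes -/

/-- **`R(x, {x}) ≥ (1 − A(x))/(1 − A)`** for every state `x` (measurable singletons). [ours] -/
theorem residual_indepMH_apply_singleton_ge [MeasurableSingletonClass Ω] [Fact (Measurable w)] (hw0 : ∀ y, 0 < w y)
    {x₀ : Ω} (hmax : ∀ y, w y ≤ w x₀) [IsProbabilityMeasure (q.withDensity fun y => ENNReal.ofReal (w y))] (x : Ω) :
    (1 - ENNReal.ofReal (w x₀)⁻¹)⁻¹ * (1 - imhAcceptMass q w x) ≤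
      Doeblin.residualKernel (indepMH q w) (q.withDensity fun y => ENNReal.ofReal (w y))
        (ENNReal.ofReal (w x₀)⁻¹) (indepMH_minorised_mode Fact.out hw0 hmax) x {x} := by
  rw [residual_indepMH_apply hw0 hmax x (measurableSet_singleton x), Set.indicator_of_mem (Set.mem_singleton x), Pi.one_apply,
    mul_one]
  exact mul_le_mul' le_rfl le_add_self

/-- **With an atom-free proposal at `x`** (`q{x} = 0`): `R(x, {x}) = (1 − A(x))/(1 − A)` exactly. [ours] -/
theorem residual_indepMH_apply_singleton_eq [MeasurableSingletonClass Ω] [Fact (Measurable w)] (hw0 : ∀ y, 0 < w y)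
    {x₀ : Ω} (hmax : ∀ y, w y ≤ w x₀) [IsProbabilityMeasure (q.withDensity fun y => ENNReal.ofReal (w y))] {x : Ω}
    (hqx : q {x} = 0) :
    Doeblin.residualKernel (indepMH q w) (q.withDensity fun y => ENNReal.ofReal (w y))
        (ENNReal.ofReal (w x₀)⁻¹) (indepMH_minorised_mode Fact.out hw0 hmax) x {x} =
      (1 - ENNReal.ofReal (w x₀)⁻¹)⁻¹ * (1 - imhAcceptMass q w x) := by
  rw [residual_indepMH_apply hw0 hmax x (measurableSet_singleton x), Set.indicator_of_mem (Set.mem_singleton x), Pi.one_apply,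
    mul_one, Measure.restrict_zero_set hqx, lintegral_zero_measure, zero_add]

/-- **THE RESIDUAL CHAIN IS ABSORBED EXACTLY AT THE STATES OF MINIMAL ACCEPTANCE**: for an atom-free `x`,
`R(x, {x}) = 1 ↔ A(x) = 1/w(x₀)` (the acceptance mass at `x` equals its floor, i.e. `x` is a mode of `w`). [ours] -/
theorem residual_indepMH_apply_singleton_eq_one_iff [MeasurableSingletonClass Ω] [Fact (Measurable w)]
    (hw0 : ∀ y, 0 < w y) {x₀ : Ω} (hmax : ∀ y, w y ≤ w x₀) (hlt : 1 < w x₀)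
    [IsProbabilityMeasure (q.withDensity fun y => ENNReal.ofReal (w y))] {x : Ω} (hqx : q {x} = 0) :
    Doeblin.residualKernel (indepMH q w) (q.withDensity fun y => ENNReal.ofReal (w y))
        (ENNReal.ofReal (w x₀)⁻¹) (indepMH_minorised_mode Fact.out hw0 hmax) x {x} = 1 ↔
      imhAcceptMass q w x = ENNReal.ofReal (w x₀)⁻¹ := by
  set ε : ℝ≥0∞ := ENNReal.ofReal (w x₀)⁻¹ with hε
  have hε1 : ε < 1 := ofReal_inv_lt_one_of_one_lt hlt
  have h1e : 1 - ε ≠ 0 := (tsub_pos_of_lt hε1).ne'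
  have h1t : 1 - ε ≠ ⊤ := ne_top_of_le_ne_top ENNReal.one_ne_top tsub_le_self
  have hAle : imhAcceptMass q w x ≤ 1 := imhAcceptMass_le_one q w x
  -- the acceptance mass is at least its floor `ε` (the Doeblin minorisation at `B = univ ∖ …` is not needed:
  -- `K(x, {x}ᶜ) ≥ ε π({x}ᶜ)` suffices through the closed form)
  rw [residual_indepMH_apply_singleton_eq hw0 hmax hqx, ← hε]
  constructor
  · intro h
    -- `(1 − ε)⁻¹ (1 − A x) = 1 ⇒ 1 − A x = 1 − ε ⇒ A x = ε`
    have h2 : 1 - imhAcceptMass q w x = 1 - ε := by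
      have := congrArg (fun z => (1 - ε) * z) h
      rwa [← mul_assoc, ENNReal.mul_inv_cancel h1e h1t, one_mul, mul_one] at this
    have hAt : imhAcceptMass q w x ≠ ⊤ := ne_top_of_le_ne_top ENNReal.one_ne_top hAle
    have hεt : ε ≠ ⊤ := ENNReal.ofReal_ne_top
    have := congrArg (fun z => 1 - z) h2
    rwa [ENNReal.sub_sub_cancel ENNReal.one_ne_top hAle, ENNReal.sub_sub_cancel ENNReal.one_ne_top hε1.le] at this
  · intro h
    rw [h, ENNReal.inv_mul_cancel h1e h1t]

end Summit.Ventures.LatticeQCDFlow.Exactness
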